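import Summits.CriticalPhenomena.Ising3DConformalLimit.Theses.FKParityRobustness
import Literature.Probability.Percolation.SiteConnectionTools
import HarnessLib
import HarnessLib.Audit

/-!
# Skeleton — crux `IndependentStrandsJoin` (stmt-CriticalPhenomena-14625), line `Sketch`
# (the tetrahedral sandwich of Card A, `Cruxes/IndependentStrandsJoin/Ideas/tetrahedral-sandwich.md`)

Route `FKParityRobustness`, sub-problem `Ising3DConformalLimit`.  Line lead
`prover-line-stmt-CriticalPhenomena-14625-0`, cycle 1 (2026-08-16).

THE LINE.  On every finite graph `G` with `t = tanh β`, `Z^B = loopO1PartitionFunction G t B`,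
`𝒯(B) = tJoins G univ B`, four distinct marked vertices `a`, and the two sums

* `meetSum = Σ_{F₁ ∈ 𝒯(a₀a₁)} Σ_{F₂ ∈ 𝒯(a₂a₃)} t^{|F₁|+|F₂|} 1[∃ v, a₀ ↝_{F₁} v ∧ a₂ ↝_{F₂} v]`
  (the two source clusters share a vertex — termwise below the crux's joint sum),
* `sepSum = Σ_{D ∈ 𝒯(a₀a₁a₂a₃), a₀ ↝̸_D a₂, a₀ ↝̸_D a₃} t^{|D|}` (four-source `T`-joins pairing `01|23`),

the following chain holds:

1. `stub_depletionBound` — the route's lever `DepletionBound` (item 14628, verbatim): AF86 Claim (4.15)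
   super-multiplicativity moved to the source cluster of a `T`-join.
2. `stub_pairSplit` — the exact pair-split deletion identity (★)
   `Σ_{F₁ ∈ 𝒯(a₀a₁) clean} t^{|F₁|} ⟨σ_{a₂}σ_{a₃}⟩_{G ∖ V(K_{a₀}F₁)} = sepSum`
   (kernel-checked by the standing disprover of `StrandShadow`, `pairSplitDeletionIdentity_holds`; to be ported).
3. `stub_separation` — (1) + (2) give the SEPARATION BOUND `Z^{01} Z^{23} − meetSum ≤ sepSum · Z⁰`.
4. `stub_symmetry` — under the pairing symmetry of `(G, a)` (automorphisms fixing `a₀` realising the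
   transpositions `(a₁a₂)`, `(a₁a₃)`): `3 · sepSum ≤ Z^{0123}`, `Z^{02}Z^{13} = Z^{01}Z^{23} = Z^{03}Z^{12}`.
5. `stub_boxSymmetry` — the boxes `Λ_N ⊂ ℤ³` with `a = l · tetra` HAVE the pairing symmetry
   (coordinate transpositions `y ↔ z`, `x ↔ z`).
6. `stub_transfer` — (3) + (4) + (5) + the HT expansions `⟨σ_B⟩ = Z^B/Z⁰` give
   `−U₄ (Z⁰)² = 3 Z^{01}Z^{23} − Z^{0123} Z⁰ ≤ 3 · meetSum ≤ 3 · jointSum` in every box, so the lattice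
   `U₄`-hyperscaling `TetraU4Lattice` (7) implies the crux with constant `c/3`.
7. `stub_tetraU4Lattice` — `U₄^{Λ_N}(l·tetra) ≤ −c ⟨σ_{a₀}σ_{a₁}⟩_{Λ_N} ⟨σ_{a₂}σ_{a₃}⟩_{Λ_N}` at `β_c`,
   uniformly in `l ≥ 1` (`N ≥ N₀(l)`): the lattice clause (iii) of the conjunct at regular tetrahedra —
   THE open content (non-Gaussianity of critical 3D Ising in hyperscaling form); the line lead's stub.

`IndependentStrandsJoin_of` assumes exactly the seven registered stubs (name-keyed `Registered.stub_*`)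
and concludes the crux BY NAME.  The converse `IndependentStrandsJoin → TetraU4Lattice` (constant `2c`)
is `StrandsJoinBound` (PROVED, `strandsJoinBound_proof`) + `defect_of_join`; so the crux and (7) are
ONE statement.

Stub statements are INLINED in the registered `stub_*` theorems (no new tree definitions): stubs land
as theorem-only `--supports stmt-CriticalPhenomena-14625` files under `Theorems/`.
-/

noncomputable section

open Finset SimpleGraph
open Literature.Probability.LatticeModels
open Summit.CriticalPhenomena.Ising3DConformalLimit.Theses.FKParityRobustness

namespace Summit.CriticalPhenomena.Ising3DConformalLimit.FKParityRobustnessIndependentStrandsJoin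

open scoped Classical BigOperators

/-! ### The stub STATEMENTS (named `Prop`s, used only by the composition; the registered `stub_*`
theorems below restate them verbatim, fully inlined) -/

/-- Statement of Stub 2, the pair-split deletion identity (★). -/
def PairSplitIdentity : Prop :=
  ∀ (V : Type) [Fintype V] [DecidableEq V] (G : SimpleGraph V) [DecidableRel G.Adj] (β : ℝ),
    0 ≤ β → ∀ a : Fin 4 → V, Function.Injective a →
    (∑ F ∈ (tJoins G Set.univ {a 0, a 1}).filter (fun F : Finset (Sym2 V) =>
          ¬ (SimpleGraph.fromEdgeSet (↑F : Set (Sym2 V))).Reachable (a 0) (a 2) ∧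
          ¬ (SimpleGraph.fromEdgeSet (↑F : Set (Sym2 V))).Reachable (a 0) (a 3)),
        Real.tanh β ^ F.card *
          isingCorr G (Finset.univ.filter (fun v : V =>
            ¬ (SimpleGraph.fromEdgeSet (↑F : Set (Sym2 V))).Reachable (a 0) v)) β 0 .free {a 2, a 3})
      = ∑ D ∈ (tJoins G Set.univ (Finset.univ.image a)).filter (fun D : Finset (Sym2 V) =>
          ¬ (SimpleGraph.fromEdgeSet (↑D : Set (Sym2 V))).Reachable (a 0) (a 2) ∧
          ¬ (SimpleGraph.fromEdgeSet (↑D : Set (Sym2 V))).Reachable (a 0) (a 3)),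
        Real.tanh β ^ D.card

/-- Statement of the SEPARATION BOUND `Z^{01} Z^{23} − meetSum ≤ sepSum · Z⁰` (conclusion of Stub 3). -/
def SeparationBound : Prop :=
  ∀ (V : Type) [Fintype V] [DecidableEq V] (G : SimpleGraph V) [DecidableRel G.Adj] (β : ℝ),
    0 ≤ β → ∀ a : Fin 4 → V, Function.Injective a →
    loopO1PartitionFunction G (Real.tanh β) {a 0, a 1} * loopO1PartitionFunction G (Real.tanh β) {a 2, a 3}
      - (∑ F₁ ∈ tJoins G Set.univ {a 0, a 1}, ∑ F₂ ∈ tJoins G Set.univ {a 2, a 3},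
          if ∃ v : V, (SimpleGraph.fromEdgeSet (↑F₁ : Set (Sym2 V))).Reachable (a 0) v ∧
              (SimpleGraph.fromEdgeSet (↑F₂ : Set (Sym2 V))).Reachable (a 2) v
          then Real.tanh β ^ (F₁.card + F₂.card) else 0)
      ≤ (∑ D ∈ (tJoins G Set.univ (Finset.univ.image a)).filter (fun D : Finset (Sym2 V) =>
          ¬ (SimpleGraph.fromEdgeSet (↑D : Set (Sym2 V))).Reachable (a 0) (a 2) ∧
          ¬ (SimpleGraph.fromEdgeSet (↑D : Set (Sym2 V))).Reachable (a 0) (a 3)),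
          Real.tanh β ^ D.card) * loopO1PartitionFunction G (Real.tanh β) ∅

/-- Statement of Stub 3 (glue): depletion bound + (★) ⟹ separation bound. -/
def SeparationGlue : Prop :=
  DepletionBound → PairSplitIdentity → SeparationBound

/-- Statement of Stub 4: pairing symmetry on a general graph. -/
def PairingSymmetryBound : Prop :=
  ∀ (V : Type) [Fintype V] [DecidableEq V] (G : SimpleGraph V) [DecidableRel G.Adj] (t : ℝ),
    0 ≤ t → ∀ a : Fin 4 → V, Function.Injective a →
    (∃ φ : G ≃g G, φ (a 0) = a 0 ∧ φ (a 1) = a 2 ∧ φ (a 2) = a 1 ∧ φ (a 3) = a 3) →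
    (∃ ψ : G ≃g G, ψ (a 0) = a 0 ∧ ψ (a 1) = a 3 ∧ ψ (a 3) = a 1 ∧ ψ (a 2) = a 2) →
    3 * (∑ D ∈ (tJoins G Set.univ (Finset.univ.image a)).filter (fun D : Finset (Sym2 V) =>
          ¬ (SimpleGraph.fromEdgeSet (↑D : Set (Sym2 V))).Reachable (a 0) (a 2) ∧
          ¬ (SimpleGraph.fromEdgeSet (↑D : Set (Sym2 V))).Reachable (a 0) (a 3)),
          t ^ D.card)
        ≤ loopO1PartitionFunction G t (Finset.univ.image a) ∧
    loopO1PartitionFunction G t {a 0, a 2} * loopO1PartitionFunction G t {a 1, a 3} =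
      loopO1PartitionFunction G t {a 0, a 1} * loopO1PartitionFunction G t {a 2, a 3} ∧
    loopO1PartitionFunction G t {a 0, a 3} * loopO1PartitionFunction G t {a 1, a 2} =
      loopO1PartitionFunction G t {a 0, a 1} * loopO1PartitionFunction G t {a 2, a 3}

/-- Statement of Stub 5: the boxes with `a = l · tetra` have the pairing symmetry. -/
def BoxPairingSymmetry : Prop :=
  ∀ (l N : ℕ) (a : Fin 4 → ↥(box 3 N)),
    (∀ i, ((a i : Site 3)) = (l : ℤ) •
      (![![-1, -1, -1], ![1, 1, -1], ![1, -1, 1], ![-1, 1, 1]] : Fin 4 → Site 3) i) →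
    (∃ φ : ((zdGraph 3).comap (Subtype.val : ↥(box 3 N) → Site 3)) ≃g
        ((zdGraph 3).comap (Subtype.val : ↥(box 3 N) → Site 3)),
        φ (a 0) = a 0 ∧ φ (a 1) = a 2 ∧ φ (a 2) = a 1 ∧ φ (a 3) = a 3) ∧
    (∃ ψ : ((zdGraph 3).comap (Subtype.val : ↥(box 3 N) → Site 3)) ≃g
        ((zdGraph 3).comap (Subtype.val : ↥(box 3 N) → Site 3)),
        ψ (a 0) = a 0 ∧ ψ (a 1) = a 3 ∧ ψ (a 3) = a 1 ∧ ψ (a 2) = a 2)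

/-- Statement of Stub 7: `TetraU4Lattice`, the lattice clause (iii) at regular tetrahedra. -/
def TetraU4Lattice : Prop :=
  ∃ c : ℝ, 0 < c ∧ ∀ l : ℕ, 1 ≤ l → ∃ N₀ : ℕ, ∀ N : ℕ, N₀ ≤ N → ∀ a : Fin 4 → ↥(box 3 N),
    (∀ i, ((a i : Site 3)) = (l : ℤ) •
      (![![-1, -1, -1], ![1, 1, -1], ![1, -1, 1], ![-1, 1, 1]] : Fin 4 → Site 3) i) →
    connectedFour (isingMeasure ((zdGraph 3).comap (Subtype.val : ↥(box 3 N) → Site 3))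
        Finset.univ (criticalBeta 3) 0 .free) spinAt a
      ≤ -(c * isingCorr ((zdGraph 3).comap (Subtype.val : ↥(box 3 N) → Site 3)) Finset.univ
            (criticalBeta 3) 0 .free {a 0, a 1} *
          isingCorr ((zdGraph 3).comap (Subtype.val : ↥(box 3 N) → Site 3)) Finset.univ
            (criticalBeta 3) 0 .free {a 2, a 3})

/-- The crux's statement, verbatim (the body of the route decl `IndependentStrandsJoin`). -/
def CruxBody : Prop :=
  let tetra : Fin 4 → Literature.Probability.LatticeModels.Site 3 := ![![-1, -1, -1], ![1, 1, -1], ![1, -1, 1], ![-1, 1, 1]]; ∃ c : ℝ, 0 < c ∧ ∀ l : ℕ, 1 ≤ l → ∃ N₀ : ℕ, ∀ N : ℕ, N₀ ≤ N → ∀ a : Fin 4 → ↥(Literature.Probability.LatticeModels.box 3 N), (∀ i, ((a i : Literature.Probability.LatticeModels.Site 3)) = (l : ℤ) • tetra i) → (let G := ((Literature.Probability.LatticeModels.zdGraph 3).comap (Subtype.val : ↥(Literature.Probability.LatticeModels.box 3 N) → Literature.Probability.LatticeModels.Site 3)); let t : ℝ := Real.tanh (Literature.Probability.LatticeModels.criticalBeta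 3); c * Literature.Probability.LatticeModels.loopO1PartitionFunction G t {a 0, a 1} * Literature.Probability.LatticeModels.loopO1PartitionFunction G t {a 2, a 3} ≤ ∑ F₁ ∈ Literature.Probability.LatticeModels.tJoins G Set.univ {a 0, a 1}, ∑ F₂ ∈ Literature.Probability.LatticeModels.tJoins G Set.univ {a 2, a 3}, if (SimpleGraph.fromEdgeSet ((↑F₁ : Set (Sym2 ↥(Literature.Probability.LatticeModels.box 3 N))) ∪ ↑F₂)).Reachable (a 0) (a 2) then t ^ (F₁.card + F₂.card) else 0)

/-- Statement of Stub 6 (the transfer). -/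
def Transfer : Prop :=
  SeparationBound → PairingSymmetryBound → BoxPairingSymmetry → TetraU4Lattice → CruxBody

/-! ### Name-keyed aliases of the registered stubs (the hypotheses of the composition) -/
namespace Registered

/-- Alias of `DepletionBound` (route item 14628) keyed by the registered stub name. -/
abbrev stub_depletionBound : Prop := DepletionBound
/-- Alias of `PairSplitIdentity` keyed by the registered stub name. -/
abbrev stub_pairSplit : Prop := PairSplitIdentity
/-- Alias of `SeparationGlue` keyed by the registered stub name. -/
abbrev stub_separation : Prop := SeparationGlue
/-- Alias of `PairingSymmetryBound` keyed by the registered stub name. -/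
abbrev stub_symmetry : Prop := PairingSymmetryBound
/-- Alias of `BoxPairingSymmetry` keyed by the registered stub name. -/
abbrev stub_boxSymmetry : Prop := BoxPairingSymmetry
/-- Alias of `Transfer` keyed by the registered stub name. -/
abbrev stub_transfer : Prop := Transfer
/-- Alias of `TetraU4Lattice` keyed by the registered stub name. -/
abbrev stub_tetraU4Lattice : Prop := TetraU4Lattice

end Registered

/-! ### The composition: the seven registered stubs imply the crux, BY NAME -/

/-- **The line closes the crux modulo its stubs**: `IndependentStrandsJoin` from the registered stubs
1–7 (depletion bound, (★), separation glue, pairing symmetry, box symmetry, transfer, `TetraU4Lattice`). -/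
theorem IndependentStrandsJoin_of (h1 : Registered.stub_depletionBound) (h2 : Registered.stub_pairSplit)
    (h3 : Registered.stub_separation) (h4 : Registered.stub_symmetry) (h5 : Registered.stub_boxSymmetry)
    (h6 : Registered.stub_transfer) (h7 : Registered.stub_tetraU4Lattice) : IndependentStrandsJoin :=
  h6 (h3 h1 h2) h4 h5 h7

/-! ### The registered stubs (`sorry` lives ONLY here); statements verbatim, fully inlined -/

/-- **Stub 1 (`DepletionBound`, route item stmt-CriticalPhenomena-14628 verbatim).**  On every finite
graph, `β ≥ 0`, `x, y ∉ S`: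
`(Σ_{F ∈ 𝒯(xy), K_x(F) avoids S} t^{|F|}) · ⟨σ_xσ_y⟩^free_G ≤ Z^{xy} · ⟨σ_xσ_y⟩^free_{G ∖ S}`.
Proof: fibre decomposition `F ↦ (K_x(F), F ∖ K)` + vertex-set supermodularity of `Λ ↦ g_Λ(∅)`
(`DepletionBound.hteSum_empty_supermodular`, landed) + HT expansion `isingCorr_free_eq_hteSum_div`. -/
theorem stub_depletionBound : DepletionBound := by
  sorry

/-- **Stub 2 (pair-split deletion identity (★)).**  For `F₁ ∈ 𝒯(a₀a₁)` whose `a₀`-cluster avoids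
`a₂, a₃`, summing the depleted pair correlation `⟨σ_{a₂}σ_{a₃}⟩^free` of the volume NOT reached from
`a₀` against `t^{|F₁|}` reproduces the four-source loop sum restricted to the split `01|23`.
Kernel-checked in `Cruxes/StrandShadow/Disproof.lean` (`pairSplitDeletionIdentity_holds`); port. -/
theorem stub_pairSplit :
    ∀ (V : Type) [Fintype V] [DecidableEq V] (G : SimpleGraph V) [DecidableRel G.Adj] (β : ℝ),
      0 ≤ β → ∀ a : Fin 4 → V, Function.Injective a →
      (∑ F ∈ (tJoins G Set.univ {a 0, a 1}).filter (fun F : Finset (Sym2 V) =>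
            ¬ (SimpleGraph.fromEdgeSet (↑F : Set (Sym2 V))).Reachable (a 0) (a 2) ∧
            ¬ (SimpleGraph.fromEdgeSet (↑F : Set (Sym2 V))).Reachable (a 0) (a 3)),
          Real.tanh β ^ F.card *
            isingCorr G (Finset.univ.filter (fun v : V =>
              ¬ (SimpleGraph.fromEdgeSet (↑F : Set (Sym2 V))).Reachable (a 0) v)) β 0 .free {a 2, a 3})
        = ∑ D ∈ (tJoins G Set.univ (Finset.univ.image a)).filter (fun D : Finset (Sym2 V) =>
            ¬ (SimpleGraph.fromEdgeSet (↑D : Set (Sym2 V))).Reachable (a 0) (a 2) ∧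
            ¬ (SimpleGraph.fromEdgeSet (↑D : Set (Sym2 V))).Reachable (a 0) (a 3)),
          Real.tanh β ^ D.card := by
  sorry

/-- **Stub 3 (separation glue).**  From the depletion bound (route decl `DepletionBound`) and (★):
`Z^{01} Z^{23} − meetSum ≤ sepSum · Z⁰` on every finite graph, `β ≥ 0`, `a` injective.
Per `F₁`: if `a₂` or `a₃` is in the `a₀`-cluster every `F₂` meets it (a `T`-join of a pair joins its
pair); otherwise the non-meeting `F₂` avoid `S = V(K_{a₀}F₁) ∌ a₂,a₃`, the depletion bound gives
`Avoid(S) ≤ Z⁰ ⟨σ₂σ₃⟩_{G∖S}` (divide by `⟨σ₂σ₃⟩_G = Z^{23}/Z⁰`, or `Z^{23} = 0`), and (★) sums it. -/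
theorem stub_separation :
    DepletionBound →
    (∀ (V : Type) [Fintype V] [DecidableEq V] (G : SimpleGraph V) [DecidableRel G.Adj] (β : ℝ),
      0 ≤ β → ∀ a : Fin 4 → V, Function.Injective a →
      (∑ F ∈ (tJoins G Set.univ {a 0, a 1}).filter (fun F : Finset (Sym2 V) =>
            ¬ (SimpleGraph.fromEdgeSet (↑F : Set (Sym2 V))).Reachable (a 0) (a 2) ∧
            ¬ (SimpleGraph.fromEdgeSet (↑F : Set (Sym2 V))).Reachable (a 0) (a 3)),
          Real.tanh β ^ F.card *
            isingCorr G (Finset.univ.filter (fun v : V =>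
              ¬ (SimpleGraph.fromEdgeSet (↑F : Set (Sym2 V))).Reachable (a 0) v)) β 0 .free {a 2, a 3})
        = ∑ D ∈ (tJoins G Set.univ (Finset.univ.image a)).filter (fun D : Finset (Sym2 V) =>
            ¬ (SimpleGraph.fromEdgeSet (↑D : Set (Sym2 V))).Reachable (a 0) (a 2) ∧
            ¬ (SimpleGraph.fromEdgeSet (↑D : Set (Sym2 V))).Reachable (a 0) (a 3)),
          Real.tanh β ^ D.card) →
    ∀ (V : Type) [Fintype V] [DecidableEq V] (G : SimpleGraph V) [DecidableRel G.Adj] (β : ℝ),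
      0 ≤ β → ∀ a : Fin 4 → V, Function.Injective a →
      loopO1PartitionFunction G (Real.tanh β) {a 0, a 1} * loopO1PartitionFunction G (Real.tanh β) {a 2, a 3}
        - (∑ F₁ ∈ tJoins G Set.univ {a 0, a 1}, ∑ F₂ ∈ tJoins G Set.univ {a 2, a 3},
            if ∃ v : V, (SimpleGraph.fromEdgeSet (↑F₁ : Set (Sym2 V))).Reachable (a 0) v ∧
                (SimpleGraph.fromEdgeSet (↑F₂ : Set (Sym2 V))).Reachable (a 2) v
            then Real.tanh β ^ (F₁.card + F₂.card) else 0)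
        ≤ (∑ D ∈ (tJoins G Set.univ (Finset.univ.image a)).filter (fun D : Finset (Sym2 V) =>
            ¬ (SimpleGraph.fromEdgeSet (↑D : Set (Sym2 V))).Reachable (a 0) (a 2) ∧
            ¬ (SimpleGraph.fromEdgeSet (↑D : Set (Sym2 V))).Reachable (a 0) (a 3)),
            Real.tanh β ^ D.card) * loopO1PartitionFunction G (Real.tanh β) ∅ := by
  sorry

/-- **Stub 4 (pairing symmetry, general graph).**  If `G` has automorphisms fixing `a₀` that realise
the transpositions `(a₁ a₂)` and `(a₁ a₃)` on the marked quadruple, then the three separated pairing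
classes of `𝒯(a₀a₁a₂a₃)` have equal weight (so `3 · sepSum ≤ Z^{0123}`, the classes being disjoint by
the handshake lemma) and the pair partition functions are exchanged: `Z^{02}Z^{13} = Z^{01}Z^{23} = Z^{03}Z^{12}`
(transport of `tJoins` along a graph isomorphism). -/
theorem stub_symmetry :
    ∀ (V : Type) [Fintype V] [DecidableEq V] (G : SimpleGraph V) [DecidableRel G.Adj] (t : ℝ),
      0 ≤ t → ∀ a : Fin 4 → V, Function.Injective a →
      (∃ φ : G ≃g G, φ (a 0) = a 0 ∧ φ (a 1) = a 2 ∧ φ (a 2) = a 1 ∧ φ (a 3) = a 3) →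
      (∃ ψ : G ≃g G, ψ (a 0) = a 0 ∧ ψ (a 1) = a 3 ∧ ψ (a 3) = a 1 ∧ ψ (a 2) = a 2) →
      3 * (∑ D ∈ (tJoins G Set.univ (Finset.univ.image a)).filter (fun D : Finset (Sym2 V) =>
            ¬ (SimpleGraph.fromEdgeSet (↑D : Set (Sym2 V))).Reachable (a 0) (a 2) ∧
            ¬ (SimpleGraph.fromEdgeSet (↑D : Set (Sym2 V))).Reachable (a 0) (a 3)),
            t ^ D.card)
          ≤ loopO1PartitionFunction G t (Finset.univ.image a) ∧
      loopO1PartitionFunction G t {a 0, a 2} * loopO1PartitionFunction G t {a 1, a 3} =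
        loopO1PartitionFunction G t {a 0, a 1} * loopO1PartitionFunction G t {a 2, a 3} ∧
      loopO1PartitionFunction G t {a 0, a 3} * loopO1PartitionFunction G t {a 1, a 2} =
        loopO1PartitionFunction G t {a 0, a 1} * loopO1PartitionFunction G t {a 2, a 3} := by
  sorry

/-- **Stub 5 (box pairing symmetry).**  For `a = l · tetra` in the box `Λ_N = {-N,…,N}³` with its
induced nearest-neighbour graph, the coordinate transpositions `y ↔ z` and `x ↔ z` (restricted
`zdSignedPermIso`, `signedPerm_mem_box_iff`) are graph automorphisms fixing `a₀ = l(−1,−1,−1)` and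
realising `(a₁ a₂)`, resp. `(a₁ a₃)`. -/
theorem stub_boxSymmetry :
    ∀ (l N : ℕ) (a : Fin 4 → ↥(box 3 N)),
      (∀ i, ((a i : Site 3)) = (l : ℤ) •
        (![![-1, -1, -1], ![1, 1, -1], ![1, -1, 1], ![-1, 1, 1]] : Fin 4 → Site 3) i) →
      (∃ φ : ((zdGraph 3).comap (Subtype.val : ↥(box 3 N) → Site 3)) ≃g
          ((zdGraph 3).comap (Subtype.val : ↥(box 3 N) → Site 3)),
          φ (a 0) = a 0 ∧ φ (a 1) = a 2 ∧ φ (a 2) = a 1 ∧ φ (a 3) = a 3) ∧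
      (∃ ψ : ((zdGraph 3).comap (Subtype.val : ↥(box 3 N) → Site 3)) ≃g
          ((zdGraph 3).comap (Subtype.val : ↥(box 3 N) → Site 3)),
          ψ (a 0) = a 0 ∧ ψ (a 1) = a 3 ∧ ψ (a 3) = a 1 ∧ ψ (a 2) = a 2) := by
  sorry

/-- **Stub 7 (`TetraU4Lattice`, the lattice clause (iii) at regular tetrahedra; line lead).**  There is
`c > 0` such that for every `l ≥ 1`, all large `N` and `a = l · tetra ⊂ Λ_N`, the free critical Ising
measure of the induced box graph satisfies `U₄(a) ≤ −c · ⟨σ_{a₀}σ_{a₁}⟩ · ⟨σ_{a₂}σ_{a₃}⟩`.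
Equivalent to the crux (constants `c/3` down, `2c` up); the `d = 3` content of the line. -/
theorem stub_tetraU4Lattice :
    ∃ c : ℝ, 0 < c ∧ ∀ l : ℕ, 1 ≤ l → ∃ N₀ : ℕ, ∀ N : ℕ, N₀ ≤ N → ∀ a : Fin 4 → ↥(box 3 N),
      (∀ i, ((a i : Site 3)) = (l : ℤ) •
        (![![-1, -1, -1], ![1, 1, -1], ![1, -1, 1], ![-1, 1, 1]] : Fin 4 → Site 3) i) →
      connectedFour (isingMeasure ((zdGraph 3).comap (Subtype.val : ↥(box 3 N) → Site 3))
          Finset.univ (criticalBeta 3) 0 .free) spinAt a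
        ≤ -(c * isingCorr ((zdGraph 3).comap (Subtype.val : ↥(box 3 N) → Site 3)) Finset.univ
              (criticalBeta 3) 0 .free {a 0, a 1} *
            isingCorr ((zdGraph 3).comap (Subtype.val : ↥(box 3 N) → Site 3)) Finset.univ
              (criticalBeta 3) 0 .free {a 2, a 3}) := by
  sorry

/-- **Stub 6 (transfer).**  Separation bound + pairing symmetry + box symmetry + `TetraU4Lattice`
give the crux's statement with constant `c/3`: in the box, `U₄ (Z⁰)² = Z^{0123} Z⁰ − 3 Z^{01}Z^{23}` (HT
expansions `nPoint = Z^{0123}/Z⁰`, `twoPoint = Z^{xy}/Z⁰`, and the two `Z`-identities of Stub 4), so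
`3 (Z^{01}Z^{23} − meetSum) ≤ 3 sepSum Z⁰ ≤ Z^{0123} Z⁰ = 3 Z^{01}Z^{23} + U₄ (Z⁰)² ≤ (3 − c) Z^{01}Z^{23}`,
i.e. `meetSum ≥ (c/3) Z^{01} Z^{23}`, and `meetSum ≤ jointSum` termwise (a shared vertex `v` joins
`a₀ ↝_{F₁} v ↝_{F₂} a₂`).  The conclusion is the body of the route decl `IndependentStrandsJoin`, verbatim. -/
theorem stub_transfer :
    (∀ (V : Type) [Fintype V] [DecidableEq V] (G : SimpleGraph V) [DecidableRel G.Adj] (β : ℝ),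
      0 ≤ β → ∀ a : Fin 4 → V, Function.Injective a →
      loopO1PartitionFunction G (Real.tanh β) {a 0, a 1} * loopO1PartitionFunction G (Real.tanh β) {a 2, a 3}
        - (∑ F₁ ∈ tJoins G Set.univ {a 0, a 1}, ∑ F₂ ∈ tJoins G Set.univ {a 2, a 3},
            if ∃ v : V, (SimpleGraph.fromEdgeSet (↑F₁ : Set (Sym2 V))).Reachable (a 0) v ∧
                (SimpleGraph.fromEdgeSet (↑F₂ : Set (Sym2 V))).Reachable (a 2) v
            then Real.tanh β ^ (F₁.card + F₂.card) else 0)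
        ≤ (∑ D ∈ (tJoins G Set.univ (Finset.univ.image a)).filter (fun D : Finset (Sym2 V) =>
            ¬ (SimpleGraph.fromEdgeSet (↑D : Set (Sym2 V))).Reachable (a 0) (a 2) ∧
            ¬ (SimpleGraph.fromEdgeSet (↑D : Set (Sym2 V))).Reachable (a 0) (a 3)),
            Real.tanh β ^ D.card) * loopO1PartitionFunction G (Real.tanh β) ∅) →
    (∀ (V : Type) [Fintype V] [DecidableEq V] (G : SimpleGraph V) [DecidableRel G.Adj] (t : ℝ),
      0 ≤ t → ∀ a : Fin 4 → V, Function.Injective a →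
      (∃ φ : G ≃g G, φ (a 0) = a 0 ∧ φ (a 1) = a 2 ∧ φ (a 2) = a 1 ∧ φ (a 3) = a 3) →
      (∃ ψ : G ≃g G, ψ (a 0) = a 0 ∧ ψ (a 1) = a 3 ∧ ψ (a 3) = a 1 ∧ ψ (a 2) = a 2) →
      3 * (∑ D ∈ (tJoins G Set.univ (Finset.univ.image a)).filter (fun D : Finset (Sym2 V) =>
            ¬ (SimpleGraph.fromEdgeSet (↑D : Set (Sym2 V))).Reachable (a 0) (a 2) ∧
            ¬ (SimpleGraph.fromEdgeSet (↑D : Set (Sym2 V))).Reachable (a 0) (a 3)),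
            t ^ D.card)
          ≤ loopO1PartitionFunction G t (Finset.univ.image a) ∧
      loopO1PartitionFunction G t {a 0, a 2} * loopO1PartitionFunction G t {a 1, a 3} =
        loopO1PartitionFunction G t {a 0, a 1} * loopO1PartitionFunction G t {a 2, a 3} ∧
      loopO1PartitionFunction G t {a 0, a 3} * loopO1PartitionFunction G t {a 1, a 2} =
        loopO1PartitionFunction G t {a 0, a 1} * loopO1PartitionFunction G t {a 2, a 3}) →
    (∀ (l N : ℕ) (a : Fin 4 → ↥(box 3 N)),
      (∀ i, ((a i : Site 3)) = (l : ℤ) •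
        (![![-1, -1, -1], ![1, 1, -1], ![1, -1, 1], ![-1, 1, 1]] : Fin 4 → Site 3) i) →
      (∃ φ : ((zdGraph 3).comap (Subtype.val : ↥(box 3 N) → Site 3)) ≃g
          ((zdGraph 3).comap (Subtype.val : ↥(box 3 N) → Site 3)),
          φ (a 0) = a 0 ∧ φ (a 1) = a 2 ∧ φ (a 2) = a 1 ∧ φ (a 3) = a 3) ∧
      (∃ ψ : ((zdGraph 3).comap (Subtype.val : ↥(box 3 N) → Site 3)) ≃g
          ((zdGraph 3).comap (Subtype.val : ↥(box 3 N) → Site 3)),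
          ψ (a 0) = a 0 ∧ ψ (a 1) = a 3 ∧ ψ (a 3) = a 1 ∧ ψ (a 2) = a 2)) →
    (∃ c : ℝ, 0 < c ∧ ∀ l : ℕ, 1 ≤ l → ∃ N₀ : ℕ, ∀ N : ℕ, N₀ ≤ N → ∀ a : Fin 4 → ↥(box 3 N),
      (∀ i, ((a i : Site 3)) = (l : ℤ) •
        (![![-1, -1, -1], ![1, 1, -1], ![1, -1, 1], ![-1, 1, 1]] : Fin 4 → Site 3) i) →
      connectedFour (isingMeasure ((zdGraph 3).comap (Subtype.val : ↥(box 3 N) → Site 3))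
          Finset.univ (criticalBeta 3) 0 .free) spinAt a
        ≤ -(c * isingCorr ((zdGraph 3).comap (Subtype.val : ↥(box 3 N) → Site 3)) Finset.univ
              (criticalBeta 3) 0 .free {a 0, a 1} *
            isingCorr ((zdGraph 3).comap (Subtype.val : ↥(box 3 N) → Site 3)) Finset.univ
              (criticalBeta 3) 0 .free {a 2, a 3})) →
    (let tetra : Fin 4 → Literature.Probability.LatticeModels.Site 3 := ![![-1, -1, -1], ![1, 1, -1], ![1, -1, 1], ![-1, 1, 1]]; ∃ c : ℝ, 0 < c ∧ ∀ l : ℕ, 1 ≤ l → ∃ N₀ : ℕ, ∀ N : ℕ, N₀ ≤ N → ∀ a : Fin 4 → ↥(Literature.Probability.LatticeModels.box 3 N), (∀ i, ((a i : Literature.Probability.LatticeModels.Site 3)) = (l : ℤ) • tetra i) → (let G := ((Literature.Probability.LatticeModels.zdGraph 3).comap (Subtype.val : ↥(Literature.Probability.LatticeModels.box 3 N) → Literature.Probability.LatticeModels.Site 3)); let t : ℝ := Real.tanh (Literature.Probability.LatticeModels.criticalBeta 3); c * Literature.Probability.LatticeModels.loopO1PartitionFunction G t {a 0, a 1} * Literature.Probability.LatticeModels.loopO1PartitionFunction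 G t {a 2, a 3} ≤ ∑ F₁ ∈ Literature.Probability.LatticeModels.tJoins G Set.univ {a 0, a 1}, ∑ F₂ ∈ Literature.Probability.LatticeModels.tJoins G Set.univ {a 2, a 3}, if (SimpleGraph.fromEdgeSet ((↑F₁ : Set (Sym2 ↥(Literature.Probability.LatticeModels.box 3 N))) ∪ ↑F₂)).Reachable (a 0) (a 2) then t ^ (F₁.card + F₂.card) else 0)) := by
  sorry

/-! ### Consistency: each registered stub IS its name-keyed alias (definitionally), and the wiring -/

example : Registered.stub_depletionBound := stub_depletionBound
example : Registered.stub_pairSplit := stub_pairSplit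
example : Registered.stub_separation := stub_separation
example : Registered.stub_symmetry := stub_symmetry
example : Registered.stub_boxSymmetry := stub_boxSymmetry
example : Registered.stub_transfer := stub_transfer
example : Registered.stub_tetraU4Lattice := stub_tetraU4Lattice
example : CruxBody ↔ IndependentStrandsJoin := Iff.rfl

/-- Wiring check: the registered stubs feed `IndependentStrandsJoin_of` as stated. -/
example : IndependentStrandsJoin :=
  IndependentStrandsJoin_of stub_depletionBound stub_pairSplit stub_separation stub_symmetry
    stub_boxSymmetry stub_transfer stub_tetraU4Lattice

end Summit.CriticalPhenomena.Ising3DConformalLimit.FKParityRobustnessIndependentStrandsJoin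

end

-- h21 skeleton audit (appended by ledger skeleton check)
#h21_check_skeleton "stmt-CriticalPhenomena-14625" Summit.CriticalPhenomena.Ising3DConformalLimit.Theses.FKParityRobustness.IndependentStrandsJoin stub_depletionBound stub_pairSplit stub_separation stub_symmetry stub_boxSymmetry stub_tetraU4Lattice stub_transfer
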